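import Summits.CriticalPhenomena.CardyFormulaZ2.Theorems.CardySusyWardDiscretisationFamilyExistsLattice
import HarnessLib

/-!
# Inner faces are full cells — helper for `DiscretisationFamilyExists` (stmt-CriticalPhenomena-9644)

For a regular open set `Ω` (exterior `(closure Ω)ᶜ` connected and unbounded, `∂Ω` in the closure
of the exterior — every Jordan domain, `regular_of_eq_carrier`) and `δ > 0`:

* `isFull_of_isInnerFace`: the OPEN cell of an inner face lies in `Ω` (its four closed sides lie
  in `closure Ω`, so the connected unbounded exterior, if it entered the open cell, could never
  leave it);
* `closure_cell_subset_of_isInnerFace`: its closed cell lies in `closure Ω`;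
* `rect_subset_of_isInnerFace_h/v`: the open rectangle across the common side of two inner faces
  lies in `Ω` — in particular the open side carries NO point of `∂Ω`
  (`not_mem_frontier_of_mem_openSegment_h/v`), the fact behind "a boundary point on an open
  lattice segment forces one of the two adjacent faces to be non-inner" used in the selection of
  the cut edge.
-/

noncomputable section

open Set Metric Complex
open Literature.Probability.LatticeModels Literature.Probability.Percolation
  Literature.Probability.LatticeModels.Mesh Literature.Probability.LatticeModels.DiscreteDobrushin

namespace Summit.CriticalPhenomena.CardyFormulaZ2.Theorems.DiscretisationFamilyExists

/-- The mesh point of a `Bool`-corner, in coordinates. [folklore] -/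
theorem meshPoint_corner (δ : ℝ) (k j : ℤ) (a b : Bool) :
    meshPoint δ (corner k j a b) =
      ⟨δ * (k + if a then 1 else 0), δ * (j + if b then 1 else 0)⟩ := by
  apply Complex.ext <;> cases a <;> cases b <;> simp [corner]

/-- A point of the closed cell off the open cell lies on one of the four closed sides (a segment
between two lattice-adjacent corners). [folklore] -/
theorem exists_mem_segment_of_mem_closure_cell {δ : ℝ} (hδ : 0 < δ) (k j : ℤ) {z : ℂ}
    (hz : z ∈ closure (cell δ k j)) (hz' : z ∉ cell δ k j) :
    ∃ a b a' b' : Bool, (zdGraph 2).Adj (corner k j a b) (corner k j a' b') ∧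
      z ∈ segment ℝ (meshPoint δ (corner k j a b)) (meshPoint δ (corner k j a' b')) := by
  rw [closure_cell hδ, mem_reProdIm] at hz
  obtain ⟨hre, him⟩ := hz
  have h1 : δ * k < δ * (k + 1) := by nlinarith
  have h2 : δ * j < δ * (j + 1) := by nlinarith
  have hnot : ¬ (z.re ∈ Ioo (δ * k) (δ * (k + 1)) ∧ z.im ∈ Ioo (δ * j) (δ * (j + 1))) := fun h =>
    hz' (mem_reProdIm.2 h)
  by_cases hre' : z.re ∈ Ioo (δ * k) (δ * (k + 1))
  · have him' : z.im ∉ Ioo (δ * j) (δ * (j + 1)) := fun h => hnot ⟨hre', h⟩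
    rcases eq_or_eq_of_mem_Icc_of_not_mem_Ioo him him' with h | h
    · -- bottom side
      refine ⟨false, false, true, false, zdGraph_adj_corner_horizontal k j false, ?_⟩
      rw [meshPoint_corner, meshPoint_corner]
      simpa using mem_segment_of_im_eq h1 hre h
    · -- top side
      refine ⟨false, true, true, true, zdGraph_adj_corner_horizontal k j true, ?_⟩
      rw [meshPoint_corner, meshPoint_corner]
      simpa using mem_segment_of_im_eq h1 hre h
  · rcases eq_or_eq_of_mem_Icc_of_not_mem_Ioo hre hre' with h | h
    · -- left side
      refine ⟨false, false, false, true, zdGraph_adj_corner_vertical k j false, ?_⟩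
      rw [meshPoint_corner, meshPoint_corner]
      simpa using mem_segment_of_re_eq h2 him h
    · -- right side
      refine ⟨true, false, true, true, zdGraph_adj_corner_vertical k j true, ?_⟩
      rw [meshPoint_corner, meshPoint_corner]
      simpa using mem_segment_of_re_eq h2 him h

/-- **The open cell of an inner face lies in the domain** (regular `Ω`: connected unbounded
exterior, `∂Ω ⊆ closure (closure Ω)ᶜ`). The four closed sides of an inner face lie in `closure Ω`
(they are mesh edges); if the exterior met the open cell it would be trapped in it (preconnected,
and it cannot touch the sides), contradicting unboundedness. [folklore] -/
theorem isFull_of_isInnerFace {E : DiscreteDobrushin} (hΩ : IsOpen E.Ω)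
    (hJE : frontier E.Ω ⊆ closure (closure E.Ω)ᶜ) (hext : IsConnected (closure E.Ω)ᶜ)
    (hunb : ¬ Bornology.IsBounded (closure E.Ω)ᶜ) (hδ : 0 < E.δ) {f : Site 2}
    (hf : E.IsInnerFace f) : IsFull E.Ω E.δ (f 0) (f 1) := by
  by_contra h
  obtain ⟨x, hx, hxE⟩ := exists_mem_cell_exterior_of_not_isFull hΩ hJE h
  have hsub : (closure E.Ω)ᶜ ⊆ cell E.δ (f 0) (f 1) := by
    refine hext.isPreconnected.subset_of_closure_inter_subset (isOpen_cell _ _ _) ⟨x, hxE, hx⟩ ?_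
    rintro z ⟨hzc, hzE⟩
    by_contra hz'
    obtain ⟨a, b, a', b', hadj, hzseg⟩ := exists_mem_segment_of_mem_closure_cell hδ _ _ hzc hz'
    exact hzE (segment_subset_closure_of_isInnerFace hf (isCorner_corner f a b)
      (isCorner_corner f a' b') hadj hzseg)
  refine hunb (Bornology.IsBounded.subset ?_ (hsub.trans subset_closure))
  rw [closure_cell hδ]
  exact (isCompact_Icc.reProdIm isCompact_Icc).isBounded

/-- The closed cell of an inner face lies in `closure Ω` (regular `Ω`). [folklore] -/
theorem closure_cell_subset_of_isInnerFace {E : DiscreteDobrushin} (hΩ : IsOpen E.Ω)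
    (hJE : frontier E.Ω ⊆ closure (closure E.Ω)ᶜ) (hext : IsConnected (closure E.Ω)ᶜ)
    (hunb : ¬ Bornology.IsBounded (closure E.Ω)ᶜ) (hδ : 0 < E.δ) {f : Site 2}
    (hf : E.IsInnerFace f) : closure (cell E.δ (f 0) (f 1)) ⊆ closure E.Ω :=
  (isFull_of_isInnerFace hΩ hJE hext hunb hδ hf).closure_subset

/-- An open set inside `closure Ω` lies inside `Ω` (regular `Ω`: a frontier point inside it
would bring exterior points). [folklore] -/
theorem subset_of_isOpen_of_subset_closure {Ω U : Set ℂ} (hΩ : IsOpen Ω)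
    (hJE : frontier Ω ⊆ closure (closure Ω)ᶜ) (hU : IsOpen U) (hUΩ : U ⊆ closure Ω) : U ⊆ Ω := by
  intro z hz
  by_contra hzΩ
  obtain ⟨x, hxU, hxE⟩ := exists_mem_exterior_of_isOpen hΩ hJE hU hz hzΩ
  exact hxE (hUΩ hxU)

/-- **The open rectangle across the common horizontal side of two inner faces lies in `Ω`.**
Faces `![k, j₀ - 1]` (below) and `![k, j₀]` (above), both inner. [folklore] -/
theorem rect_subset_of_isInnerFace_h {E : DiscreteDobrushin} (hΩ : IsOpen E.Ω)
    (hJE : frontier E.Ω ⊆ closure (closure E.Ω)ᶜ) (hext : IsConnected (closure E.Ω)ᶜ)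
    (hunb : ¬ Bornology.IsBounded (closure E.Ω)ᶜ) (hδ : 0 < E.δ) {k j₀ : ℤ}
    (h₁ : E.IsInnerFace ![k, j₀ - 1]) (h₂ : E.IsInnerFace ![k, j₀]) :
    (Ioo (E.δ * k) (E.δ * (k + 1)) ×ℂ Ioo (E.δ * (j₀ - 1)) (E.δ * (j₀ + 1))) ⊆ E.Ω := by
  refine subset_of_isOpen_of_subset_closure hΩ hJE (isOpen_Ioo.reProdIm isOpen_Ioo) ?_
  refine (rect_subset_closure_cells_h hδ k j₀).trans (union_subset ?_ ?_)
  · simpa using closure_cell_subset_of_isInnerFace hΩ hJE hext hunb hδ h₁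
  · simpa using closure_cell_subset_of_isInnerFace hΩ hJE hext hunb hδ h₂

/-- **The open rectangle across the common vertical side of two inner faces lies in `Ω`.**
Faces `![k₀ - 1, j]` (left) and `![k₀, j]` (right), both inner. [folklore] -/
theorem rect_subset_of_isInnerFace_v {E : DiscreteDobrushin} (hΩ : IsOpen E.Ω)
    (hJE : frontier E.Ω ⊆ closure (closure E.Ω)ᶜ) (hext : IsConnected (closure E.Ω)ᶜ)
    (hunb : ¬ Bornology.IsBounded (closure E.Ω)ᶜ) (hδ : 0 < E.δ) {k₀ j : ℤ}
    (h₁ : E.IsInnerFace ![k₀ - 1, j]) (h₂ : E.IsInnerFace ![k₀, j]) :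
    (Ioo (E.δ * (k₀ - 1)) (E.δ * (k₀ + 1)) ×ℂ Ioo (E.δ * j) (E.δ * (j + 1))) ⊆ E.Ω := by
  refine subset_of_isOpen_of_subset_closure hΩ hJE (isOpen_Ioo.reProdIm isOpen_Ioo) ?_
  refine (rect_subset_closure_cells_v hδ k₀ j).trans (union_subset ?_ ?_)
  · simpa using closure_cell_subset_of_isInnerFace hΩ hJE hext hunb hδ h₁
  · simpa using closure_cell_subset_of_isInnerFace hΩ hJE hext hunb hδ h₂

/-- **No boundary point on the open common horizontal side of two inner faces**: a point
`z` with `δk < re z < δ(k+1)` and `im z = δ j₀` is in `Ω`. [folklore] -/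
theorem mem_of_mem_open_side_h {E : DiscreteDobrushin} (hΩ : IsOpen E.Ω)
    (hJE : frontier E.Ω ⊆ closure (closure E.Ω)ᶜ) (hext : IsConnected (closure E.Ω)ᶜ)
    (hunb : ¬ Bornology.IsBounded (closure E.Ω)ᶜ) (hδ : 0 < E.δ) {k j₀ : ℤ}
    (h₁ : E.IsInnerFace ![k, j₀ - 1]) (h₂ : E.IsInnerFace ![k, j₀]) {z : ℂ}
    (hre : z.re ∈ Ioo (E.δ * k) (E.δ * (k + 1))) (him : z.im = E.δ * j₀) : z ∈ E.Ω := by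
  refine rect_subset_of_isInnerFace_h hΩ hJE hext hunb hδ h₁ h₂ (mem_reProdIm.2 ⟨hre, ?_⟩)
  rw [him]
  constructor <;> nlinarith

/-- **No boundary point on the open common vertical side of two inner faces**: a point
`z` with `re z = δ k₀` and `δj < im z < δ(j+1)` is in `Ω`. [folklore] -/
theorem mem_of_mem_open_side_v {E : DiscreteDobrushin} (hΩ : IsOpen E.Ω)
    (hJE : frontier E.Ω ⊆ closure (closure E.Ω)ᶜ) (hext : IsConnected (closure E.Ω)ᶜ)
    (hunb : ¬ Bornology.IsBounded (closure E.Ω)ᶜ) (hδ : 0 < E.δ) {k₀ j : ℤ}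
    (h₁ : E.IsInnerFace ![k₀ - 1, j]) (h₂ : E.IsInnerFace ![k₀, j]) {z : ℂ}
    (hre : z.re = E.δ * k₀) (him : z.im ∈ Ioo (E.δ * j) (E.δ * (j + 1))) : z ∈ E.Ω := by
  refine rect_subset_of_isInnerFace_v hΩ hJE hext hunb hδ h₁ h₂ (mem_reProdIm.2 ⟨?_, him⟩)
  rw [hre]
  constructor <;> nlinarith

end Summit.CriticalPhenomena.CardyFormulaZ2.Theorems.DiscretisationFamilyExists

end
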